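import Literature.NumberTheory.NumberFields.AmbiguousClassGaloisAction
import Literature.NumberTheory.Automorphic.GaloisActionPlaces
import HarnessLib

/-!
# Prime exponents of fractional ideals: uniqueness/existence, the Galois action, and extension

Topic `NumberTheory/NumberFields`; namespace `Literature.NumberTheory.NumberFields.AmbiguousIdeal`.
Theorem-only file (no definition, no named fact): the bookkeeping of the exponents
`ord_𝔭(I) = FractionalIdeal.count K 𝔭 I` of an invertible fractional ideal `I ∈ 𝓘 = (FractionalIdeal R⁰ K)ˣ`
of a Dedekind domain that the tree's proof of Chevalley's ambiguous class number formula
(`AmbiguousClassNumberFormula.lean`) runs on: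

* `units_ext_count`, `exists_units_count_eq` — **`𝓘 ≅ ⊕_𝔭 ℤ`**: an invertible fractional ideal is
  determined by its exponents, and every finitely supported exponent vector occurs (Neukirch I (3.9):
  "every fractional ideal `𝔞` admits a unique representation `𝔞 = ∏_𝔭 𝔭^{ν_𝔭}` with `ν_𝔭 ∈ ℤ`,
  almost all `ν_𝔭 = 0`; `J_K` is the free abelian group on the nonzero prime ideals").
* `count_units_mul`, `count_units_inv`, `count_units_div`, `count_units_prod`, `count_units_zpow` —
  `ord_𝔭` is a homomorphism on `𝓘`.
* `fracIdealAut_coeIdeal`, `count_smul_coeIdeal`, `count_smul`, `count_smul'` — for a Galois automorphism `σ` of a number field `L/K` acting on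
  `𝓘_L` (the tree's `AmbiguousClass.mulDistribMulActionFracIdealUnits`) and on the primes (the tree's
  `instMulActionHeightOneSpectrum`): **`ord_{σ𝔓}(σ I) = ord_𝔓(I)`** (Cassels–Fröhlich VII §1.1).
* `count_coeIdeal_map`, `count_extendedHom`, `ramificationIdx_eq_ramificationIdxIn` — **`ord_𝔓(𝔞𝓞_L) = e(𝔓|𝔭) · ord_𝔭(𝔞)`** for the extension
  `i_{L/K} = FractionalIdeal.extendedHom` of fractional ideals (Neukirch I (8.2)/(III (1.6)):
  `𝔭𝓞_L = ∏ 𝔓^{e_𝔓}`; Mathlib `emultiplicity_map_eq_ramificationIdx'_mul`).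

## References

* J. Neukirch, *Algebraic Number Theory* (1999), Ch. I §3 Cor. (3.9); Ch. I §8 Prop. (8.2);
  Ch. III §1 Prop. (1.6). [NeukirchANT1999]
* J. W. S. Cassels, A. Fröhlich (eds.), *Algebraic Number Theory* (1967), Ch. VII §1.1. [CasselsFrohlichANT1967]
* S. Lang, *Cyclotomic Fields I and II* (1990), Ch. 13 §4, proof of Lemma 4.1 ("`I_K` is the direct sum of
  its semilocal components over primes of `F`"). [Lang1990]
-/

noncomputable section

open NumberField IsDedekindDomain FractionalIdeal
open scoped nonZeroDivisors Pointwise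

namespace Literature.NumberTheory.NumberFields.AmbiguousIdeal

/-! ### Exponent vectors of invertible fractional ideals of a Dedekind domain -/

section Dedekind

variable {R : Type*} [CommRing R] [IsDedekindDomain R] (K : Type*) [Field K] [Algebra R K]
  [IsFractionRing R K]

/-- **Uniqueness of the factorisation `I = ∏_𝔭 𝔭^{ord_𝔭 I}`**: two invertible fractional ideals with
the same exponents at every prime are equal. [cite: NeukirchANT1999, Ch. I §3 Cor. (3.9)] -/
theorem units_ext_count {I J : (FractionalIdeal R⁰ K)ˣ}
    (h : ∀ v : HeightOneSpectrum R, count K v (I : FractionalIdeal R⁰ K) = count K v (J : FractionalIdeal R⁰ K)) :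
    I = J := by
  apply Units.ext
  rw [← finprod_heightOneSpectrum_factorization' K I.ne_zero,
    ← finprod_heightOneSpectrum_factorization' K J.ne_zero]
  exact finprod_congr fun v => by rw [h v]

/-- **Existence: every finitely supported exponent vector is the factorisation of an invertible
fractional ideal** (`J_K` is free abelian on the primes). [cite: NeukirchANT1999, Ch. I §3 Cor. (3.9)] -/
theorem exists_units_count_eq (e : HeightOneSpectrum R → ℤ)
    (he : ∀ᶠ v in Filter.cofinite, e v = 0) :
    ∃ I : (FractionalIdeal R⁰ K)ˣ, ∀ v, count K v (I : FractionalIdeal R⁰ K) = e v := by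
  have hne : (∏ᶠ v : HeightOneSpectrum R, (v.asIdeal : FractionalIdeal R⁰ K) ^ e v) ≠ 0 :=
    finprod_induction (fun x => x ≠ 0) one_ne_zero (fun _ _ hx hy => mul_ne_zero hx hy)
      fun v => zpow_ne_zero _ (coeIdeal_ne_zero.mpr v.ne_bot)
  exact ⟨Units.mk0 _ hne, fun v => by rw [Units.val_mk0, count_finprod K v e he]⟩

/-- `ord_𝔭(I J) = ord_𝔭 I + ord_𝔭 J` on invertible fractional ideals (`J_K ≅ ⊕_𝔭 ℤ` is a group
isomorphism). [cite: NeukirchANT1999, Ch. I §3 Cor. (3.9)] -/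
theorem count_units_mul (v : HeightOneSpectrum R) (I J : (FractionalIdeal R⁰ K)ˣ) :
    count K v ((I * J : (FractionalIdeal R⁰ K)ˣ) : FractionalIdeal R⁰ K) =
      count K v (I : FractionalIdeal R⁰ K) + count K v (J : FractionalIdeal R⁰ K) := by
  rw [Units.val_mul, count_mul K v I.ne_zero J.ne_zero]

/-- `ord_𝔭(I⁻¹) = -ord_𝔭 I` on invertible fractional ideals. [cite: NeukirchANT1999, Ch. I §3 Cor. (3.9)] -/
theorem count_units_inv (v : HeightOneSpectrum R) (I : (FractionalIdeal R⁰ K)ˣ) :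
    count K v ((I⁻¹ : (FractionalIdeal R⁰ K)ˣ) : FractionalIdeal R⁰ K) =
      -count K v (I : FractionalIdeal R⁰ K) := by
  rw [Units.val_inv_eq_inv_val, count_inv]

/-- `ord_𝔭(I / J) = ord_𝔭 I - ord_𝔭 J` on invertible fractional ideals. [cite: NeukirchANT1999, Ch. I §3 Cor. (3.9)] -/
theorem count_units_div (v : HeightOneSpectrum R) (I J : (FractionalIdeal R⁰ K)ˣ) :
    count K v ((I / J : (FractionalIdeal R⁰ K)ˣ) : FractionalIdeal R⁰ K) =
      count K v (I : FractionalIdeal R⁰ K) - count K v (J : FractionalIdeal R⁰ K) := by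
  rw [div_eq_mul_inv, count_units_mul, count_units_inv, sub_eq_add_neg]

/-- `ord_𝔭(∏ᵢ Iᵢ) = ∑ᵢ ord_𝔭 Iᵢ` on invertible fractional ideals. [cite: NeukirchANT1999, Ch. I §3 Cor. (3.9)] -/
theorem count_units_prod {ι : Type*} (s : Finset ι) (v : HeightOneSpectrum R)
    (I : ι → (FractionalIdeal R⁰ K)ˣ) :
    count K v ((∏ i ∈ s, I i : (FractionalIdeal R⁰ K)ˣ) : FractionalIdeal R⁰ K) =
      ∑ i ∈ s, count K v (I i : FractionalIdeal R⁰ K) := by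
  rw [Units.coe_prod]
  exact count_prod K v s _ fun i _ => (I i).ne_zero

/-- `ord_𝔭(I ^ n) = n · ord_𝔭 I` (`n ∈ ℤ`) on invertible fractional ideals. [cite: NeukirchANT1999, Ch. I §3 Cor. (3.9)] -/
theorem count_units_zpow (v : HeightOneSpectrum R) (I : (FractionalIdeal R⁰ K)ˣ) (n : ℤ) :
    count K v ((I ^ n : (FractionalIdeal R⁰ K)ˣ) : FractionalIdeal R⁰ K) =
      n * count K v (I : FractionalIdeal R⁰ K) := by
  rw [Units.val_zpow_eq_zpow_val, count_zpow]

/-- The exponents of an invertible fractional ideal vanish off a finite set ("almost all `ν_𝔭 = 0`").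
[cite: NeukirchANT1999, Ch. I §3 Cor. (3.9)] -/
theorem finite_setOf_count_ne_zero (I : (FractionalIdeal R⁰ K)ˣ) :
    {v : HeightOneSpectrum R | count K v (I : FractionalIdeal R⁰ K) ≠ 0}.Finite :=
  finite_factors (I : FractionalIdeal R⁰ K)

/-- `ord_𝔭` of a nonzero integral ideal is its multiplicity in the prime factorisation (a Summits file
of the tree has the same statement as `count_coe_eq_multiplicity`; Literature may not import it). [folklore] -/
private theorem count_coeIdeal_eq_multiplicity (v : HeightOneSpectrum R) {J : Ideal R} (hJ : J ≠ ⊥) :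
    count K v (J : FractionalIdeal R⁰ K) = multiplicity v.asIdeal J := by
  classical
  rw [count_coe K v hJ, Ideal.count_associates_factors_eq hJ v.isPrime v.ne_bot,
    HeightOneSpectrum.count_normalizedFactors_eq_multiplicity hJ]

end Dedekind

/-! ### The Galois action on exponents -/

section Galois

open Literature.NumberTheory.NumberFields.AmbiguousClass Literature.NumberTheory.Automorphic

variable {K L : Type*} [Field K] [Field L] [NumberField L] [Algebra K L]

omit [NumberField L] in
/-- The two ring automorphisms of `𝓞 L` attached to `σ ∈ Aut(L/K)` agree: the tree's
`AmbiguousClass.intAut σ` and Mathlib's `MulSemiringAction` ("`σ𝔬 = 𝔬`": `σ` restricts to an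
automorphism of the integers). [cite: NeukirchANT1999, Ch. I §9 (p. 54, before Prop. (9.1))] -/
theorem toRingHom_eq_intAut (σ : L ≃ₐ[K] L) :
    MulSemiringAction.toRingHom (L ≃ₐ[K] L) (𝓞 L) σ = (intAut σ : 𝓞 L →+* 𝓞 L) :=
  RingHom.ext fun _ => RingOfIntegers.ext rfl

omit [NumberField L] in
/-- `σ • J = J.map (intAut σ)` for an integral ideal `J` (the conjugate ideal `σ𝔞`).
[cite: NeukirchANT1999, Ch. I §9 (p. 54, before Prop. (9.1))] -/
theorem smul_ideal_eq_map (σ : L ≃ₐ[K] L) (J : Ideal (𝓞 L)) :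
    σ • J = J.map (intAut σ : 𝓞 L →+* 𝓞 L) := by
  rw [Ideal.pointwise_smul_def, toRingHom_eq_intAut]

/-- **`σ` acts on an integral ideal through its extension**: `σ • (J : fractional ideal) = (σ • J)`.
[cite: CasselsFrohlichANT1967, Ch. VII §1.1] -/
theorem fracIdealAut_coeIdeal (σ : L ≃ₐ[K] L) (J : Ideal (𝓞 L)) :
    fracIdealAut σ (J : FractionalIdeal (𝓞 L)⁰ L) = ((σ • J : Ideal (𝓞 L)) : FractionalIdeal (𝓞 L)⁰ L) := by
  rw [fracIdealAut, ringEquivOfRingEquiv_coeIdeal, smul_ideal_eq_map]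

omit [NumberField L] in
/-- `σ • (x) = (σ x)` for `x ∈ 𝓞 L` (conjugates of principal integral ideals).
[cite: CasselsFrohlichANT1967, Ch. VII §1.1] -/
theorem smul_ideal_span_singleton (σ : L ≃ₐ[K] L) (x : 𝓞 L) :
    σ • (Ideal.span {x} : Ideal (𝓞 L)) = Ideal.span {σ • x} := by
  rw [Ideal.pointwise_smul_def, Ideal.map_span, Set.image_singleton]
  rfl

/-- **`ord_{σ𝔓}(σ 𝔞) = ord_𝔓(𝔞)` for integral ideals** (as `FractionalIdeal.count`).
[cite: CasselsFrohlichANT1967, Ch. VII §1.1] -/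
theorem count_smul_coeIdeal (σ : L ≃ₐ[K] L) (w : HeightOneSpectrum (𝓞 L)) {J : Ideal (𝓞 L)}
    (hJ : J ≠ ⊥) :
    count L (σ • w) ((σ • J : Ideal (𝓞 L)) : FractionalIdeal (𝓞 L)⁰ L) =
      count L w (J : FractionalIdeal (𝓞 L)⁰ L) := by
  classical
  have hσJ : σ • J ≠ ⊥ := fun h => hJ ((Ideal.smul_eq_bot_iff σ J).mp h)
  rw [count_coe L _ hσJ, count_coe L _ hJ]
  exact_mod_cast HeightOneSpectrum.count_smul_asIdeal σ w hJ

/-- **The exponents are Galois-equivariant: `ord_{σ𝔓}(σ • I) = ord_𝔓(I)`** for every invertible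
fractional ideal `I` of `L` and `σ ∈ Aut(L/K)` (`|a|_{σw} = |σ⁻¹a|_w`).
[cite: CasselsFrohlichANT1967, Ch. VII §1.1] -/
theorem count_smul (σ : L ≃ₐ[K] L) (w : HeightOneSpectrum (𝓞 L))
    (I : (FractionalIdeal (𝓞 L)⁰ L)ˣ) :
    count L (σ • w) ((σ • I : (FractionalIdeal (𝓞 L)⁰ L)ˣ) : FractionalIdeal (𝓞 L)⁰ L) =
      count L w (I : FractionalIdeal (𝓞 L)⁰ L) := by
  obtain ⟨a, J, ha, hIJ⟩ := exists_eq_spanSingleton_mul (I : FractionalIdeal (𝓞 L)⁰ L)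
  have hJ : J ≠ ⊥ := by
    rintro rfl
    exact I.ne_zero (by rw [hIJ, coeIdeal_bot, mul_zero])
  have ha' : (Ideal.span {a} : Ideal (𝓞 L)) ≠ ⊥ := by rwa [Ne, Ideal.span_singleton_eq_bot]
  have hsa : spanSingleton (𝓞 L)⁰ (algebraMap (𝓞 L) L a)⁻¹ =
      (((Ideal.span {a} : Ideal (𝓞 L)) : FractionalIdeal (𝓞 L)⁰ L))⁻¹ := by
    rw [← spanSingleton_inv, coeIdeal_span_singleton]
  have hspan0 : ((Ideal.span {a} : Ideal (𝓞 L)) : FractionalIdeal (𝓞 L)⁰ L) ≠ 0 :=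
    coeIdeal_ne_zero.mpr ha'
  have hJ0 : (J : FractionalIdeal (𝓞 L)⁰ L) ≠ 0 := coeIdeal_ne_zero.mpr hJ
  -- the action on the two factors
  have h1 : fracIdealAut σ ((Ideal.span {a} : Ideal (𝓞 L)) : FractionalIdeal (𝓞 L)⁰ L) =
      ((σ • Ideal.span {a} : Ideal (𝓞 L)) : FractionalIdeal (𝓞 L)⁰ L) := fracIdealAut_coeIdeal σ _
  have h2 : fracIdealAut σ (J : FractionalIdeal (𝓞 L)⁰ L) =
      ((σ • J : Ideal (𝓞 L)) : FractionalIdeal (𝓞 L)⁰ L) := fracIdealAut_coeIdeal σ _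
  have hσa0 : ((σ • Ideal.span {a} : Ideal (𝓞 L)) : FractionalIdeal (𝓞 L)⁰ L) ≠ 0 :=
    coeIdeal_ne_zero.mpr fun h => ha' ((Ideal.smul_eq_bot_iff σ _).mp h)
  have hσJ0 : ((σ • J : Ideal (𝓞 L)) : FractionalIdeal (𝓞 L)⁰ L) ≠ 0 :=
    coeIdeal_ne_zero.mpr fun h => hJ ((Ideal.smul_eq_bot_iff σ _).mp h)
  rw [coe_smul_fracIdeal, hIJ, hsa, map_mul, map_inv₀, h1, h2,
    count_mul L _ (inv_ne_zero hσa0) hσJ0, count_inv, count_mul L _ (inv_ne_zero hspan0) hJ0, count_inv,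
    count_smul_coeIdeal σ w hJ, count_smul_coeIdeal σ w ha']

/-- The same with the prime moved to the other side: `ord_𝔓(σ • I) = ord_{σ⁻¹𝔓}(I)`
(`|a|_{σ w} = |σ⁻¹ a|_w`). [cite: CasselsFrohlichANT1967, Ch. VII §1.1] -/
theorem count_smul' (σ : L ≃ₐ[K] L) (w : HeightOneSpectrum (𝓞 L))
    (I : (FractionalIdeal (𝓞 L)⁰ L)ˣ) :
    count L w ((σ • I : (FractionalIdeal (𝓞 L)⁰ L)ˣ) : FractionalIdeal (𝓞 L)⁰ L) =
      count L (σ⁻¹ • w) (I : FractionalIdeal (𝓞 L)⁰ L) := by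
  rw [← count_smul σ (σ⁻¹ • w) I, smul_inv_smul]

end Galois

/-! ### Exponents of extended ideals -/

section Extension

variable (K L : Type*) [Field K] [NumberField K] [Field L] [NumberField L] [Algebra K L]

/-- **`ord_𝔓(𝔞𝓞_L) = e(𝔓 | 𝔭) · ord_𝔭(𝔞)`** for a nonzero integral ideal `𝔞` of `K` and a prime `𝔓`
of `L` above `𝔭 = 𝔓 ∩ 𝓞_K` (`𝔭𝓞_L = ∏_{𝔓 ∣ 𝔭} 𝔓^{e_𝔓}`; Mathlib
`emultiplicity_map_eq_ramificationIdx'_mul`). [cite: NeukirchANT1999, Ch. I §8 Prop. (8.2)] -/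
theorem count_coeIdeal_map (w : HeightOneSpectrum (𝓞 L)) {J : Ideal (𝓞 K)} (hJ : J ≠ ⊥) :
    count L w ((J.map (algebraMap (𝓞 K) (𝓞 L)) : Ideal (𝓞 L)) : FractionalIdeal (𝓞 L)⁰ L) =
      w.asIdeal.ramificationIdx (𝓞 K) * count K (w.under (𝓞 K)) (J : FractionalIdeal (𝓞 K)⁰ K) := by
  have hJL : J.map (algebraMap (𝓞 K) (𝓞 L)) ≠ ⊥ :=
    (Ideal.map_eq_bot_iff_of_injective (FaithfulSMul.algebraMap_injective (𝓞 K) (𝓞 L))).not.mpr hJ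
  haveI : w.asIdeal.LiesOver (w.under (𝓞 K)).asIdeal := ⟨rfl⟩
  rw [count_coeIdeal_eq_multiplicity L w hJL, count_coeIdeal_eq_multiplicity K _ hJ,
    ← Ideal.ramificationIdx'_eq_ramificationIdx (w.under (𝓞 K)).asIdeal w.asIdeal (w.under (𝓞 K)).ne_bot]
  have h := Ideal.IsDedekindDomain.emultiplicity_map_eq_ramificationIdx'_mul (S := 𝓞 L) hJ
    (w.under (𝓞 K)).irreducible w.irreducible w.ne_bot
  have hfinL : FiniteMultiplicity w.asIdeal (J.map (algebraMap (𝓞 K) (𝓞 L))) :=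
    FiniteMultiplicity.of_prime_left w.prime hJL
  have hfinK : FiniteMultiplicity (w.under (𝓞 K)).asIdeal J :=
    FiniteMultiplicity.of_prime_left (w.under (𝓞 K)).prime hJ
  rw [hfinL.emultiplicity_eq_multiplicity, hfinK.emultiplicity_eq_multiplicity] at h
  exact_mod_cast h

/-- **`ord_𝔓(i_{L/K} J) = e(𝔓 | 𝔭) · ord_𝔭(J)`** for every invertible fractional ideal `J` of `K`, where
`i_{L/K} = FractionalIdeal.extendedHom` is the extension of fractional ideals and `𝔭 = 𝔓 ∩ 𝓞_K`.
[cite: NeukirchANT1999, Ch. III §1 Prop. (1.6)] -/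
theorem count_extendedHom (w : HeightOneSpectrum (𝓞 L)) (J : (FractionalIdeal (𝓞 K)⁰ K)ˣ) :
    count L w (extendedHom L (𝓞 L) (J : FractionalIdeal (𝓞 K)⁰ K)) =
      w.asIdeal.ramificationIdx (𝓞 K) * count K (w.under (𝓞 K)) (J : FractionalIdeal (𝓞 K)⁰ K) := by
  obtain ⟨a, 𝔞, ha, hJ⟩ := exists_eq_spanSingleton_mul (J : FractionalIdeal (𝓞 K)⁰ K)
  have h𝔞 : 𝔞 ≠ ⊥ := by
    rintro rfl
    exact J.ne_zero (by rw [hJ, coeIdeal_bot, mul_zero])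
  have ha' : (Ideal.span {a} : Ideal (𝓞 K)) ≠ ⊥ := by rwa [Ne, Ideal.span_singleton_eq_bot]
  have hsa : spanSingleton (𝓞 K)⁰ (algebraMap (𝓞 K) K a)⁻¹ =
      (((Ideal.span {a} : Ideal (𝓞 K)) : FractionalIdeal (𝓞 K)⁰ K))⁻¹ := by
    rw [← spanSingleton_inv, coeIdeal_span_singleton]
  set f := (extendedHom L (𝓞 L) : FractionalIdeal (𝓞 K)⁰ K →+* FractionalIdeal (𝓞 L)⁰ L) with hf
  have hmapne : ∀ {I : Ideal (𝓞 K)}, I ≠ ⊥ →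
      ((I.map (algebraMap (𝓞 K) (𝓞 L)) : Ideal (𝓞 L)) : FractionalIdeal (𝓞 L)⁰ L) ≠ 0 := fun hI =>
    coeIdeal_ne_zero.mpr
      ((Ideal.map_eq_bot_iff_of_injective (FaithfulSMul.algebraMap_injective (𝓞 K) (𝓞 L))).not.mpr hI)
  rw [hJ, hsa, map_mul, map_inv₀, hf, extendedHom_coeIdeal_eq_map, extendedHom_coeIdeal_eq_map,
    count_mul L w (inv_ne_zero (hmapne ha')) (hmapne h𝔞), count_inv,
    count_mul K _ (inv_ne_zero (coeIdeal_ne_zero.mpr ha')) (coeIdeal_ne_zero.mpr h𝔞), count_inv,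
    count_coeIdeal_map K L w ha', count_coeIdeal_map K L w h𝔞]
  ring

/-- The ramification index of a prime of `L` over `K` is the common ramification index
`e_𝔭 = Ideal.ramificationIdxIn` of the prime `𝔭` below it (`L/K` Galois: the `e_𝔓`, `𝔓 ∣ 𝔭`, coincide
since the Galois group permutes the `𝔓 ∣ 𝔭` transitively). [cite: NeukirchANT1999, Ch. I §9 Prop. (9.1) and the remark following it] -/
theorem ramificationIdx_eq_ramificationIdxIn [IsGalois K L] (w : HeightOneSpectrum (𝓞 L)) :
    w.asIdeal.ramificationIdx (𝓞 K) = (w.under (𝓞 K)).asIdeal.ramificationIdxIn (𝓞 L) := by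
  haveI : w.asIdeal.LiesOver (w.under (𝓞 K)).asIdeal := ⟨rfl⟩
  exact (Ideal.ramificationIdxIn_eq_ramificationIdx (w.under (𝓞 K)).asIdeal w.asIdeal (L ≃ₐ[K] L)).symm

end Extension

end Literature.NumberTheory.NumberFields.AmbiguousIdeal

end
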